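import Literature.NumberTheory.LFunctions.WeilTwoPrimeOddMarginKBase
import Literature.NumberTheory.LFunctions.WeilTwoPrimeOddMarginKDataP9
import Literature.NumberTheory.LFunctions.WeilBlockRowsP
import HarnessLib

/-!
# Two-prime odd-margin certificate K: the materialized block agrees with `P_r`, rows 65–77

`WeilCert.checkPmRow` (row `k` of the claim `Pm_{kl} = P_r(2k+1, 2l+1)`) for certificate K, by `decide +kernel`. Pure proof file; nothing is asserted.
-/

noncomputable section

namespace Literature.NumberTheory.LFunctions

set_option maxHeartbeats 0 in
/-- Row 65 of the materialized block is row 65 of `P_r` (certificate K). [folklore] -/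
theorem checkPmRow1_65_weilCert23K : weilCert23KBase.checkPmRow weilCert23KNu weilCert23KPm 1 65 = true := by
  decide +kernel

set_option maxHeartbeats 0 in
/-- Row 66 of the materialized block is row 66 of `P_r` (certificate K). [folklore] -/
theorem checkPmRow1_66_weilCert23K : weilCert23KBase.checkPmRow weilCert23KNu weilCert23KPm 1 66 = true := by
  decide +kernel

set_option maxHeartbeats 0 in
/-- Row 67 of the materialized block is row 67 of `P_r` (certificate K). [folklore] -/
theorem checkPmRow1_67_weilCert23K : weilCert23KBase.checkPmRow weilCert23KNu weilCert23KPm 1 67 = true := by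
  decide +kernel

set_option maxHeartbeats 0 in
/-- Row 68 of the materialized block is row 68 of `P_r` (certificate K). [folklore] -/
theorem checkPmRow1_68_weilCert23K : weilCert23KBase.checkPmRow weilCert23KNu weilCert23KPm 1 68 = true := by
  decide +kernel

set_option maxHeartbeats 0 in
/-- Row 69 of the materialized block is row 69 of `P_r` (certificate K). [folklore] -/
theorem checkPmRow1_69_weilCert23K : weilCert23KBase.checkPmRow weilCert23KNu weilCert23KPm 1 69 = true := by
  decide +kernel

set_option maxHeartbeats 0 in
/-- Row 70 of the materialized block is row 70 of `P_r` (certificate K). [folklore] -/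
theorem checkPmRow1_70_weilCert23K : weilCert23KBase.checkPmRow weilCert23KNu weilCert23KPm 1 70 = true := by
  decide +kernel

set_option maxHeartbeats 0 in
/-- Row 71 of the materialized block is row 71 of `P_r` (certificate K). [folklore] -/
theorem checkPmRow1_71_weilCert23K : weilCert23KBase.checkPmRow weilCert23KNu weilCert23KPm 1 71 = true := by
  decide +kernel

set_option maxHeartbeats 0 in
/-- Row 72 of the materialized block is row 72 of `P_r` (certificate K). [folklore] -/
theorem checkPmRow1_72_weilCert23K : weilCert23KBase.checkPmRow weilCert23KNu weilCert23KPm 1 72 = true := by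
  decide +kernel

set_option maxHeartbeats 0 in
/-- Row 73 of the materialized block is row 73 of `P_r` (certificate K). [folklore] -/
theorem checkPmRow1_73_weilCert23K : weilCert23KBase.checkPmRow weilCert23KNu weilCert23KPm 1 73 = true := by
  decide +kernel

set_option maxHeartbeats 0 in
/-- Row 74 of the materialized block is row 74 of `P_r` (certificate K). [folklore] -/
theorem checkPmRow1_74_weilCert23K : weilCert23KBase.checkPmRow weilCert23KNu weilCert23KPm 1 74 = true := by
  decide +kernel

set_option maxHeartbeats 0 in
/-- Row 75 of the materialized block is row 75 of `P_r` (certificate K). [folklore] -/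
theorem checkPmRow1_75_weilCert23K : weilCert23KBase.checkPmRow weilCert23KNu weilCert23KPm 1 75 = true := by
  decide +kernel

set_option maxHeartbeats 0 in
/-- Row 76 of the materialized block is row 76 of `P_r` (certificate K). [folklore] -/
theorem checkPmRow1_76_weilCert23K : weilCert23KBase.checkPmRow weilCert23KNu weilCert23KPm 1 76 = true := by
  decide +kernel

set_option maxHeartbeats 0 in
/-- Row 77 of the materialized block is row 77 of `P_r` (certificate K). [folklore] -/
theorem checkPmRow1_77_weilCert23K : weilCert23KBase.checkPmRow weilCert23KNu weilCert23KPm 1 77 = true := by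
  decide +kernel


end Literature.NumberTheory.LFunctions
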